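import Summits.ResolutionOfSingularities.ResolutionOfSingularities.Theorems.HilbertSamuelEliminationSigmaMaxModificationsCorridor3WLadderMovingIsoStepCentre
import Summits.ResolutionOfSingularities.ResolutionOfSingularities.Theorems.HilbertSamuelEliminationSigmaMaxModificationsCorridor3RegularValue
import Summits.ResolutionOfSingularities.ResolutionOfSingularities.Theorems.HilbertSamuelEliminationSigmaMaxModificationsCorridor3WLadderMovingIsoDefs
import HarnessLib

/-!
# [OURS · L1 W4.2] `Moving.IsoStepCentreGermM N` HOLDS — idea-2's finite kernel of the W-top `EvIso` half (card G), DISCHARGED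
# for every origin value (crux chain w42, line `w_ladder` v6; `--supports stmt-ResolutionOfSingularities-19249`, helper)

Stub worker res-L1-w42-stub-3 (gen 3). `…Corridor3WLadderMovingIsoStepCentre` (p504495) proved the germ statement «at an ISOLATED
reached stage the canonical centre through the marked point is `{x_n}` near `x_n`» for origin values `ν ≠ Φ^{(N)}`. The regular value
`ν = Φ^{(N)}` is now covered by stub-1's fact-free invariant `IsMaximalOrigin.regularValue_invariant` (`…Corridor3RegularValue`,
p50xxxx: every stage reached from such an origin has `H^N ≡ Φ^{(N)}`), so its Hilbert–Samuel locus is the whole stage, an isolated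
marked point is an OPEN point, and the germ statement is immediate (`isoStepCentreGerm_of_eq_iterPSum`). Together:
**`isoStepCentreGermM_holds : IsoStepCentreGermM N`** — the named OURS row of `…Corridor3WLadderMovingIsoDefs` §3b (p500943) is a
THEOREM (no facts, every admissible functional oracle, every `N`, every prime, every origin value). NB: the landed defs module keeps
idea-2's sketch namespace `…Cruxes.SigmaMaxModifications.IdeasL1Idea2R4` (res-type-012, p500943), so the row is cited by that FQN.

OURS bookkeeping over the tree's rendering of CJS Rem. 6.29 (1); NOT a statement of the manuscript [Hironaka2017] nor of
[CossartJannsenSaito2020]; AI-written, weaker than expert review. References: CJS LNM 2270 Rem. 6.29 (1), Lemma 2.31, Def. 2.35,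
Def. 6.34 (i), Def. 13.3 [CossartJannsenSaito2020]; idea-2 card G / Sketch r4 §3b; stub-1's `…Corridor3RegularValue`.
-/

noncomputable section

set_option linter.dupNamespace false -- mandated namespace of this single-conjunct summit

open CategoryTheory AlgebraicGeometry TopologicalSpace Topology
open Literature.AlgebraicGeometry.Resolution Literature.RingTheory.HilbertSamuel
open Literature.AlgebraicGeometry.CossartJannsenSaito2020
open Summit.ResolutionOfSingularities.ResolutionOfSingularities.Theorems.CampaignW42
open Summit.ResolutionOfSingularities.ResolutionOfSingularities.Theorems.SigmaMaxModificationsCorridor3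

namespace Summit.ResolutionOfSingularities.ResolutionOfSingularities.Theorems.SigmaMaxModificationsCorridor3.Moving

universe u

variable {p : ℕ} {R : ∀ S : Scheme.{u}, CentreSeq S → Prop} {N : ℕ} {ν : ℕ → ℕ}

/-- At a stage all of whose points have the same Hilbert–Samuel value, the Hilbert–Samuel locus is the whole stage. [folklore] -/
theorem hsMaxLocus_eq_univ_of_hsFun_eq {W : Scheme.{u}} [IsLocallyNoetherian W] (h : ∀ w : W, Scheme.hsFun W N w = ν) :
    Scheme.hsMaxLocus W N = Set.univ := by
  ext y
  simp only [Set.mem_univ, iff_true]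
  show Maximal (· ∈ Scheme.hsValues W N) (Scheme.hsFun W N y)
  rw [h y]
  refine ⟨⟨y, h y⟩, fun μ hμ _ => ?_⟩
  obtain ⟨w, rfl⟩ := hμ
  exact (h w).le

/-- **The germ statement at the REGULAR value `ν = Φ^{(N)}`**: every stage reached from such a maximal origin has `H^N ≡ ν` (stub-1's
`regularValue_invariant`), so `(X_n)_max = X_n`, an isolated marked point is an open point, and `U = {x_n}` witnesses the germ for any
centre through `x_n`. [cite: CossartJannsenSaito2020, Rem. 6.29 (1), Lemma 2.31] -/
theorem isoStepCentreGerm_of_eq_iterPSum (hRa : OracleAdmissible R) (hν : ν = iterPSum N Phi) {X : Scheme.{u}}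
    [IsLocallyNoetherian X] {x : X} (hX : IsMaximalOrigin p N ν X x) {s : MarkedStage.{u}}
    (hs : Reaches R N ν (MarkedStage.init X x) s) (hiso : Iso N s) {C : s.W.IdealSheafData}
    (hmem : s.pt ∈ (C.support : Set s.W)) :
    ∃ U : Set s.W, IsOpen U ∧ s.pt ∈ U ∧ (C.support : Set s.W) ∩ U = {s.pt} := by
  letI := s.ln
  obtain ⟨-, hH, -, -⟩ := hX.regularValue_invariant hRa hν hs
  obtain ⟨U, hU, hUeq⟩ := hiso
  rw [hsMaxLocus_eq_univ_of_hsFun_eq hH, Set.inter_univ] at hUeq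
  refine ⟨U, hU, ?_, ?_⟩
  · rw [hUeq]
    exact Set.mem_singleton s.pt
  · rw [hUeq]
    ext y
    constructor
    · exact fun h => h.2
    · intro hy
      rw [Set.mem_singleton_iff] at hy
      subst hy
      exact ⟨hmem, Set.mem_singleton _⟩

/-- **`IsoStepCentreGermM N` HOLDS (idea-2's finite kernel, card G §3b, DISCHARGED)**: for every admissible functional oracle, every
origin value `ν` (regular or not), every maximal origin and every stage reached from it whose marked point is ISOLATED in the
Hilbert–Samuel locus, the centre of any canonical step passing through the marked point coincides with the point on an open
neighbourhood. No named fact. [cite: CossartJannsenSaito2020, Rem. 6.29 (1), Def. 6.34 (i), Def. 13.3] -/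
theorem isoStepCentreGermM_holds :
    Summit.ResolutionOfSingularities.ResolutionOfSingularities.Cruxes.SigmaMaxModifications.IdeasL1Idea2R4.IsoStepCentreGermM.{u}
      N := by
  intro R _ hRa ν X _ x p hX s hs hiso C P' hst hmem
  by_cases hν : ν = iterPSum N Phi
  · exact isoStepCentreGerm_of_eq_iterPSum hRa hν hX hs hiso hmem
  · exact isoStepCentreGerm hRa hν hX hs hiso hst hmem

end Summit.ResolutionOfSingularities.ResolutionOfSingularities.Theorems.SigmaMaxModificationsCorridor3.Moving

end
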